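import Mathlib
import Summits.NavierStokesRegularity.NavierStokesRegularity.Theorems.WakeRatchetTailRatchetScalarFrontNoSlow
import HarnessLib

/-!
# Scalar dyadic fronts (construction `DyadicScalarFronts`, stmt-NavierStokesRegularity-21808):
# ACTION CONTROLS AMPLITUDE, `sup_{t<0} |t|·a(t) ≤ A·e^{A/Λ}` (`A = ∫_{t<0} a`), and the hop gap in terms of
# the action alone

Support file for the crux `WakeRatchet.TailRatchet` (stmt-21808; refuted BY NAME modulo the construction
`WakeRatchetDyadicFront.DyadicScalarFronts`, p589335; MODEL lattice ODEs of Tao 2016 §1.2, §4 — nothing here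
concerns the Navier–Stokes equations, and no item is closed).

The action `A = ∫_{t<0} a(t) dt = ∫_ℝ ‖W₀(σ)‖ dσ` of a scalar dyadic front is the per-shell action of the
eternal solution it carries (the admissibility constant of `IsEternal.action`; invariant under the scaling
`a ↦ c·a(c·)` of the front equation, like the renormalised amplitude `g = |t|·a`).  Quasi-monotonicity
(`WakeRatchetScalarFrontPositive.quasi_monotone`: `a(u) ≥ e^{−A/Λ}a(t)` for `t ≤ u < 0`) integrated over
`[t, 0)` gives (`amp_le_action`)

  `|t|·a(t) ≤ A·e^{A/Λ}`   for every `t < 0`: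

the type-I constant of an admissible front is bounded by its action.  Feeding this into the no-slow-fronts
bound of `…ScalarFrontNoSlow` yields the hop gap in terms of `Λ` and `A` only (`no_slow_front_action`):

  `(m_A + Λ m_A² + m_A²/Λ)·(s − 1) ≥ 1/(6Λ + 2Λ⁻¹)`,  `m_A = A·e^{A/Λ}`.

So along any family of fronts with bounded ACTION the hop ratio stays away from `1` (census G2 of programme
R-glob, now modulo the action bound instead of the sup norm).

HONEST FRAMING: elementary real analysis about a MODEL lattice ODE; existence of fronts is NOT proved; an
a-priori ACTION bound along the branch is NOT proved here; nothing about Navier–Stokes.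
-/

noncomputable section

set_option linter.dupNamespace false

namespace Summit.NavierStokesRegularity.NavierStokesRegularity.Theorems

namespace WakeRatchetScalarFrontAction

open Filter Topology Set MeasureTheory intervalIntegral
open Literature.Analysis.FluidPDE Literature.Analysis.FluidPDE.TaoCascade
open WakeRatchetScalarFrontWake WakeRatchetScalarFrontPositive WakeRatchetScalarFrontNoSlow

variable {ε₀ s : ℝ} {a : ℝ → ℝ}

/-- **Action controls amplitude.**  For a non-negative integrable profile of the front equation on `t < 0`:
`|t|·a(t) ≤ A·e^{A/Λ}` for every `t < 0`, `A = ∫_{t<0} a`.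
[cite: Tao2016AveragedNS, §1.2 (dyadic model), §4 Lemma 4.1 (4.8); elementary] -/
theorem amp_le_action (hε : 0 < ε₀) (hs : 1 < s)
    (hode : ∀ t : ℝ, t < 0 → HasDerivAt a
      (bigLam ε₀ / s ^ 2 * a (t / s) ^ 2 - s / bigLam ε₀ * a t * a (s * t)) t)
    (hint : IntegrableOn a (Iio 0)) (hnn : ∀ t : ℝ, t < 0 → 0 ≤ a t) {t : ℝ} (ht : t < 0) :
    -t * a t ≤ (∫ v in Iio 0, a v) * Real.exp ((∫ v in Iio 0, a v) / bigLam ε₀) := by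
  set A : ℝ := ∫ v in Iio 0, a v with hA
  have hA0 : 0 ≤ A := setIntegral_nonneg measurableSet_Iio fun u hu => hnn u hu
  set c : ℝ := a t * Real.exp (-(A / bigLam ε₀)) with hc
  -- `a ≥ c` on `[t, 0)`
  have hlow : ∀ u ∈ Ico t 0, c ≤ a u := fun u hu => quasi_monotone hε hs hode hint hnn hu.1 hu.2
  -- integrate over `[t, 0]`
  have hIa : IntervalIntegrable a volume t 0 := by
    rw [intervalIntegrable_iff_integrableOn_Ioo_of_le ht.le]
    exact hint.mono_set fun u hu => hu.2
  have h1 : ∫ u in t..0, (c : ℝ) ≤ ∫ u in t..0, a u := by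
    refine intervalIntegral.integral_mono_on_of_le_Ioo ht.le intervalIntegrable_const hIa fun u hu => ?_
    exact hlow u ⟨hu.1.le, hu.2⟩
  have h2 : ∫ u in t..0, (c : ℝ) = -t * c := by
    rw [intervalIntegral.integral_const, smul_eq_mul]; ring
  have h3 : ∫ u in t..0, a u ≤ A := by
    rw [intervalIntegral.integral_of_le ht.le, integral_Ioc_eq_integral_Ioo]
    have hsub : (Ioo t 0 : Set ℝ) ≤ Iio 0 := fun u hu => hu.2
    exact setIntegral_mono_set hint
      ((ae_restrict_iff' measurableSet_Iio).2 (Eventually.of_forall fun u hu => hnn u hu)) hsub.eventuallyLE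
  have h4 : -t * c ≤ A := by rw [h2] at h1; exact h1.trans h3
  have e : -t * a t = (-t * c) * Real.exp (A / bigLam ε₀) := by
    rw [hc, mul_assoc, mul_assoc, ← Real.exp_add, neg_add_cancel, Real.exp_zero, mul_one]
  rw [e]
  exact mul_le_mul_of_nonneg_right h4 (Real.exp_pos _).le

/-- **Action controls amplitude, for the construction item.**  Every profile of `DyadicScalarFronts` obeys the
type-I bound `|t|·|a(t)| ≤ A·e^{A/Λ}` on `t < 0`, `A = ∫_{t<0} a`.
[cite: Tao2016AveragedNS, §1.2, §4 Lemma 4.1 (4.8); elementary] -/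
theorem typeI_of_action (hε : 0 < ε₀) (hs : 1 < s)
    (hode : ∀ t : ℝ, t < 0 → HasDerivAt a
      (bigLam ε₀ / s ^ 2 * a (t / s) ^ 2 - s / bigLam ε₀ * a t * a (s * t)) t)
    (hint : IntegrableOn a (Iio 0))
    (hbdd : ∃ t₀ : ℝ, t₀ < 0 ∧ ∃ P : ℝ, ∀ t : ℝ, t₀ ≤ t → t < 0 → |a t| ≤ P) :
    ∀ t : ℝ, t < 0 →
      |t| * |a t| ≤ (∫ v in Iio 0, a v) * Real.exp ((∫ v in Iio 0, a v) / bigLam ε₀) := by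
  have hnn := nonneg_of_front hε hs hode hint hbdd
  intro t ht
  rw [abs_of_neg ht, abs_of_nonneg (hnn t ht)]
  exact amp_le_action hε hs hode hint hnn ht

/-- **Hop gap from the action alone (census G2 modulo the action bound).**  For every non-trivial profile of
`DyadicScalarFronts` with action `A = ∫_{t<0} a` and `m_A = A·e^{A/Λ}`:
`1/(6Λ + 2Λ⁻¹) ≤ (m_A + Λ m_A² + m_A²/Λ)·(s − 1)`.
[cite: Tao2016AveragedNS, §1.2, §4; elementary] -/
theorem no_slow_front_action (hε : 0 < ε₀) (hs : 1 < s)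
    (hode : ∀ t : ℝ, t < 0 → HasDerivAt a
      (bigLam ε₀ / s ^ 2 * a (t / s) ^ 2 - s / bigLam ε₀ * a t * a (s * t)) t)
    (hint : IntegrableOn a (Iio 0))
    (hbdd : ∃ t₀ : ℝ, t₀ < 0 ∧ ∃ P : ℝ, ∀ t : ℝ, t₀ ≤ t → t < 0 → |a t| ≤ P)
    (hne : ∃ t : ℝ, t < 0 ∧ a t ≠ 0) :
    1 / (6 * bigLam ε₀ + 2 / bigLam ε₀) ≤
      ((∫ v in Iio 0, a v) * Real.exp ((∫ v in Iio 0, a v) / bigLam ε₀)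
        + bigLam ε₀ * ((∫ v in Iio 0, a v) * Real.exp ((∫ v in Iio 0, a v) / bigLam ε₀)) ^ 2
        + ((∫ v in Iio 0, a v) * Real.exp ((∫ v in Iio 0, a v) / bigLam ε₀)) ^ 2 / bigLam ε₀) * (s - 1) :=
  no_slow_front hε hs hode hint hbdd hne (typeI_of_action hε hs hode hint hbdd)

end WakeRatchetScalarFrontAction

end Summit.NavierStokesRegularity.NavierStokesRegularity.Theorems

end
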